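import Literature.Analysis.FluidPDE.TaoCascadeModeDuhamel

/-!
# Crux `PerpetualPump.AveragedTypeIBlowup` (stmt-NavierStokesRegularity-1835), line `Sketch`:
# stub `modeNormBound` — the band Duhamel bound on each Fourier mode of a local mild solution

T. Tao, *Finite time blowup for an averaged three-dimensional Navier–Stokes equation*, J. Amer.
Math. Soc. **29** (2016), 601–674 = arXiv:1402.0290v3, §4, proof of Lemma 4.1, p. 22, (4.14):
"Taking inner products of (4.14) with `ψ_{i,n}`, we have
`u_{i,n}(t) = e^{tΔ} X_{i,n}(0) ψ_{i,n} + Σ … ∫₀ᵗ X X e^{(t-t')Δ} ψ_{i,n} dt'`".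

The tree proves this projected Duhamel formula **in `L²`** for a *global* mild solution of the
cascade equation (3.3)/(4.1) with datum exactly `ψ_{i₀,n₀}`
(`IsMildSolutionFor.modeProjection_eq_modeDuhamel`, `Literature/…/TaoCascadeModeDuhamel.lean`).
This file re-runs the same argument for a mild solution on an initial segment `[0,S)` with datum
`A ψ_{i₀,n₀}` (`modeProjection_eq_duhamelV`: at a fixed `t ∈ [0,S)` the Duhamel drive
`G_{i,n}(s) = quadTermC(u(s))_{i,n}` is only needed for `s ∈ [0,t]`, so any continuous `g` agreeing
with it there may be fed to the accepted band Duhamel element `duhamelV`), and then takes norms: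
on the frequency region of the mode `(i,n)` one has `|ξ| > (1+ε₀)ⁿ`, so the band heat flow decays
like `e^{-4π²(1+ε₀)^{2n}τ}` (`norm_bandHeat_mode_le`), the datum projects to
`A ψ_{i,n} 1_{(i,n)=(i₀,n₀)}` (`modeProjection_datum`, `‖ψ_{i,n}‖ = 1`), and the drive is the real
`quadTerm` of the coefficients `X_{j,k} = Re⟨u, ψ_{j,k}⟩` (`quadTermC_eq_ofReal`). The result is the
registered stub `stub_modeNormBound` of the line's skeleton, verbatim:
`‖u_{i,n}(t)‖ ≤ e^{-4π²(1+ε₀)^{2n}t} |A| 1_{(i,n)=(i₀,n₀)} + ∫₀ᵗ |quadTerm(X)_{i,n}(s)| e^{-4π²(1+ε₀)^{2n}(t-s)} ds`.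

Nothing here closes the item (`--supports`); no statement of the route changes.

## References

* T. Tao, J. Amer. Math. Soc. 29 (2016), 601–674, arXiv:1402.0290v3, §4 Lemma 4.1, p. 22
  ((4.14), (4.15)). [`Tao2016AveragedNS`]
-/

noncomputable section

-- the summit namespace `…NavierStokesRegularity.NavierStokesRegularity…` is the tree convention
set_option linter.dupNamespace false

open MeasureTheory Set Filter Topology
open scoped ENNReal
open scoped InnerProductSpace
open Literature.Analysis.FluidPDE Literature.Analysis.FluidPDE.Tao2016
open Literature.Analysis.FluidPDE.TaoCascade (quadTerm IsSymmetricCoeff IsCancellingCoeff)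

namespace Summit.NavierStokesRegularity.NavierStokesRegularity.Theorems.PerpetualPumpAveragedTypeIBlowup

variable {ε₀ : ℝ} {m : ℕ}

/-! ### Decay of the band heat flow of a mode -/

/-- **The band heat flow of the mode `(i,n)` decays at rate `4π²(1+ε₀)^{2n}`**:
`‖S_R(τ) f‖ ≤ e^{-4π²(1+ε₀)^{2n}τ} ‖f‖` for `τ ≥ 0`, because on the region `R` of the mode
`|ξ| > (1+ε₀)ⁿ`, so the symbol `1_R(ξ) e^{-4π²τ|ξ|²}` is bounded by `e^{-4π²(1+ε₀)^{2n}τ}`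
(Tao, p. 22: the heat flow on the band `(1+ε₀)ⁿ(Bᵢ ∪ -Bᵢ)`). [cite: Tao2016AveragedNS, §4 Lemma 4.1 p. 22] -/
theorem norm_bandHeat_mode_le (hε : 0 < 1 + ε₀) (𝒟 : CascadeWaveletData ε₀ m) (i : Fin m) (n : ℤ)
    {τ : ℝ} (hτ : 0 ≤ τ) (f : L2C) :
    ‖bandHeat (measurableSet_freqRegion 𝒟 i n) (freqRegion_subset_closedBall hε 𝒟 i n) τ f‖ ≤
      Real.exp (-(4 * Real.pi ^ 2 * (1 + ε₀) ^ (2 * n) * τ)) * ‖f‖ := by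
  change ‖fourierMultiplier _ f‖ ≤ _
  refine norm_fourierMultiplier_le_of_bound _ ?_ f
  filter_upwards [MemLp.coeFn_toLp (memLp_bandHeatFn (measurableSet_freqRegion 𝒟 i n)
    (freqRegion_subset_closedBall hε 𝒟 i n) τ)] with ξ h1
  rw [h1]
  unfold bandHeatFn
  by_cases hξ : ξ ∈ freqRegion 𝒟 i n
  · rw [indicator_of_mem hξ, Complex.norm_real, Real.norm_eq_abs, abs_of_pos (Real.exp_pos _),
      Real.exp_le_exp, neg_le_neg_iff]
    have hc : 0 < (1 + ε₀) ^ n := zpow_pos hε n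
    have hlt : (1 + ε₀) ^ n < ‖ξ‖ := (𝒟.norm_of_mem_freqRegion hε i n hξ).1
    have h2 : (1 + ε₀) ^ (2 * n) ≤ ‖ξ‖ ^ 2 := by
      rw [mul_comm, zpow_mul, zpow_ofNat]
      exact pow_le_pow_left₀ hc.le hlt.le 2
    unfold heatRate
    exact mul_le_mul_of_nonneg_right (mul_le_mul_of_nonneg_left h2 (by positivity)) hτ
  · rw [indicator_of_notMem hξ, norm_zero]
    positivity

/-- **The datum term of the band Duhamel formula**: for `t ≥ 0`,
`‖S_R(t) (A ψ_{i₀,n₀})‖ ≤ e^{-4π²(1+ε₀)^{2n}t} |A| 1_{(i,n)=(i₀,n₀)}` — the projection of the datum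
to the mode `(i,n)` is `A ψ_{i,n}` or `0` ((4.8)–(4.9), `modeProjection_datum`), `‖ψ_{i,n}‖ = 1`, and
the band heat flow decays (`norm_bandHeat_mode_le`). [cite: Tao2016AveragedNS, §4 (4.8)–(4.9), (4.14)] -/
theorem norm_bandHeat_datum_le (hε₀ : 0 < ε₀) (hε : 0 < 1 + ε₀) (𝒟 : CascadeWaveletData ε₀ m)
    (i i₀ : Fin m) (n n₀ : ℤ) (A : ℝ) {t : ℝ} (ht : 0 ≤ t) :
    ‖bandHeat (measurableSet_freqRegion 𝒟 i n) (freqRegion_subset_closedBall hε 𝒟 i n) t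
        ((A : ℂ) • cascadeWavelet ε₀ (𝒟.ψ i₀) n₀)‖ ≤
      Real.exp (-(4 * Real.pi ^ 2 * (1 + ε₀) ^ (2 * n) * t)) * (if i = i₀ ∧ n = n₀ then |A| else 0) := by
  have hP : bandProj (measurableSet_freqRegion 𝒟 i n) (cascadeWavelet ε₀ (𝒟.ψ i₀) n₀) =
      if i = i₀ ∧ n = n₀ then cascadeWavelet ε₀ (𝒟.ψ i) n else 0 :=
    (bandProj_apply _ _).trans (modeProjection_datum hε₀ 𝒟 i i₀ n n₀)
  rw [map_smul, norm_smul, ← bandHeat_bandProj (measurableSet_freqRegion 𝒟 i n)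
    (freqRegion_subset_closedBall hε 𝒟 i n) t, hP]
  refine (mul_le_mul_of_nonneg_left (norm_bandHeat_mode_le hε 𝒟 i n ht _) (norm_nonneg _)).trans ?_
  rw [Complex.norm_real, Real.norm_eq_abs]
  split_ifs with h
  · rw [𝒟.norm_cascadeWavelet hε i n, mul_one, mul_comm]
  · simp

/-! ### The projected Duhamel formula in `L²` for a local solution with datum `A ψ_{i₀,n₀}` -/

section Local

variable (hε₀ : 0 < ε₀) (hε : 0 < 1 + ε₀) (𝒟 : CascadeWaveletData ε₀ m)
  (α : Fin m → Fin m → Fin m → ℤ × ℤ × ℤ → ℝ) (i₀ : Fin m) (n₀ : ℤ) (A S : ℝ) (u : ℝ → L2C)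
  (hu : IsMildSolutionFor (cascadeOperatorForm ε₀ 𝒟.ψ α) ((A : ℂ) • cascadeWavelet ε₀ (𝒟.ψ i₀) n₀)
    (Ico 0 S) u)
  (i : Fin m) (n : ℤ) {t : ℝ} (ht : t ∈ Ico 0 S) {g : ℝ → ℂ} (hg : Continuous g)
  (hgt : ∀ s ∈ Icc (0 : ℝ) t, g s = quadTermC ε₀ 𝒟.ψ α (u s) i n)

include hε₀ hu ht hg hgt in
/-- **The mild identity tested with a band-limited field, local version**: for a mild solution on
`[0,S)` with datum `A ψ_{i₀,n₀}`, `t ∈ [0,S)`, `w ∈ H¹⁰_df` band-limited to the region of `(i,n)`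
and any continuous `g` agreeing with the drive `G_{i,n}(s) = quadTermC(u(s))_{i,n}` on `[0,t]`,
`⟪w, u_{i,n}(t)⟫ = ⟪w, V(t)⟫` with `V = duhamelV … g (A ψ_{i₀,n₀}) ψ_{i,n}` (Tao, p. 22, "taking
inner products of (4.14) with `ψ_{i,n}`"; the drive is only sampled on `[0,t]`). [cite: Tao2016AveragedNS, §4 (4.14)] -/
theorem inner_modeProjection_eq_inner_duhamelV {w : L2C} (hw : MemH10df w)
    (hwb : IsBandLimited (freqRegion 𝒟 i n) w) :
    ⟪w, modeProjection 𝒟 i n (u t)⟫_ℂ =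
      ⟪w, duhamelV (measurableSet_freqRegion 𝒟 i n) (freqRegion_subset_closedBall hε 𝒟 i n) g
        ((A : ℂ) • cascadeWavelet ε₀ (𝒟.ψ i₀) n₀) (cascadeWavelet ε₀ (𝒟.ψ i) n) t⟫_ℂ := by
  have hR : MeasurableSet (freqRegion 𝒟 i n) := measurableSet_freqRegion 𝒟 i n
  have hρ := freqRegion_subset_closedBall hε 𝒟 i n
  have ht0 : (0 : ℝ) ≤ t := ht.1
  -- the mild identity (1.15)/(3.3) at `t`, tested with `w`; the cascade form collapses on `[0,t]`
  have hpair : pairing (u t) w = pairing (heat t ((A : ℂ) • cascadeWavelet ε₀ (𝒟.ψ i₀) n₀)) w +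
      ∫ s in (0 : ℝ)..t, g s * pairing (heat (t - s) w) (cascadeWavelet ε₀ (𝒟.ψ i) n) := by
    rw [hu.2.2 t ht w hw]
    congr 1
    refine intervalIntegral.integral_congr fun s hs => ?_
    rw [uIcc_of_le ht0] at hs
    rw [hgt s hs]
    exact cascadeOperatorForm_eq_quadTermC_mul (u s) (heat (t - s) w) i n
      fun j k hjk => pairing_cascadeWavelet_eq_zero_of_isBandLimited hε₀ 𝒟
        (heat_isBandLimited hwb (t - s)) j k hjk
  -- convert every pairing into an inner product against `w`
  have h1 : pairing (u t) w = ⟪w, modeProjection 𝒟 i n (u t)⟫_ℂ := by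
    rw [pairing_eq_inner hw.2.1, inner_modeProjection_eq_of_isBandLimited 𝒟 i n hwb]
  have h2 : pairing (heat t ((A : ℂ) • cascadeWavelet ε₀ (𝒟.ψ i₀) n₀)) w =
      ⟪w, bandHeat hR hρ t ((A : ℂ) • cascadeWavelet ε₀ (𝒟.ψ i₀) n₀)⟫_ℂ := by
    rw [pairing_eq_inner hw.2.1, bandHeat_freqRegion_eq hε i n ht0,
      inner_modeProjection_eq_of_isBandLimited 𝒟 i n hwb]
  have h3 : ∀ s ∈ uIcc 0 t, g s * pairing (heat (t - s) w) (cascadeWavelet ε₀ (𝒟.ψ i) n) =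
      ⟪w, g s • bandHeat hR hρ (t - s) (cascadeWavelet ε₀ (𝒟.ψ i) n)⟫_ℂ := by
    intro s hs
    rw [uIcc_of_le ht0] at hs
    have hts : 0 ≤ t - s := sub_nonneg.2 hs.2
    rw [inner_smul_right, IsReal.pairing_eq_inner ((hw.2.1).heat (t - s)),
      ← bandHeat_freqRegion_eq_heat hε i n hts hwb, inner_bandHeat_comm]
  have h3' : ∫ s in (0 : ℝ)..t, g s * pairing (heat (t - s) w) (cascadeWavelet ε₀ (𝒟.ψ i) n) =
      ∫ s in (0 : ℝ)..t, ⟪w, g s • bandHeat hR hρ (t - s) (cascadeWavelet ε₀ (𝒟.ψ i) n)⟫_ℂ :=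
    intervalIntegral.integral_congr h3
  have h4 : ∫ s in (0 : ℝ)..t, ⟪w, g s • bandHeat hR hρ (t - s) (cascadeWavelet ε₀ (𝒟.ψ i) n)⟫_ℂ =
      ⟪w, ∫ s in (0 : ℝ)..t, g s • bandHeat hR hρ (t - s) (cascadeWavelet ε₀ (𝒟.ψ i) n)⟫_ℂ := by
    have hint : IntervalIntegrable
        (fun s => g s • bandHeat hR hρ (t - s) (cascadeWavelet ε₀ (𝒟.ψ i) n)) volume 0 t :=
      (hg.smul (((continuous_bandHeat hR hρ).comp (continuous_const.sub continuous_id)).clm_apply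
        continuous_const)).intervalIntegrable 0 t
    have h := (innerSL ℂ w).intervalIntegral_comp_comm hint
    simpa only [innerSL_apply_apply] using h
  rw [h1, h2, h3', h4] at hpair
  rw [hpair, ← inner_add_right, duhamelV_eq hR hρ hg]

include hε₀ hu ht hg hgt in
/-- **The projected Duhamel formula holds in `L²`, local version**: for a mild solution on `[0,S)`
with datum `A ψ_{i₀,n₀}` and `t ∈ [0,S)`,
`u_{i,n}(t) = S_R(t)(A ψ_{i₀,n₀}) + ∫₀ᵗ G_{i,n}(s) S_R(t-s) ψ_{i,n} ds` as `L²` fields, `S_R` the heat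
flow on the band of the mode (Tao, p. 22, (4.14) projected to the mode; the difference `D` is
band-limited and divergence free, so `Re D`, `Im D ∈ H¹⁰_df` are admissible test fields and
`⟪D, D⟫ = 0`). [cite: Tao2016AveragedNS, §4 (4.14)] -/
theorem modeProjection_eq_duhamelV :
    modeProjection 𝒟 i n (u t) =
      duhamelV (measurableSet_freqRegion 𝒟 i n) (freqRegion_subset_closedBall hε 𝒟 i n) g
        ((A : ℂ) • cascadeWavelet ε₀ (𝒟.ψ i₀) n₀) (cascadeWavelet ε₀ (𝒟.ψ i) n) t := by
  have hR : MeasurableSet (freqRegion 𝒟 i n) := measurableSet_freqRegion 𝒟 i n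
  have hρ := freqRegion_subset_closedBall hε 𝒟 i n
  have hsymm : ∀ ξ : EuclideanSpace ℝ (Fin 3), -ξ ∈ freqRegion 𝒟 i n → ξ ∈ freqRegion 𝒟 i n :=
    fun ξ h => (freqRegion_symm 𝒟 i n ξ).2 h
  -- `D` is band-limited and divergence free, hence in `H¹⁰_df ⊗ ℂ`
  have hDb : IsBandLimited (freqRegion 𝒟 i n) (modeProjection 𝒟 i n (u t) -
      duhamelV hR hρ g ((A : ℂ) • cascadeWavelet ε₀ (𝒟.ψ i₀) n₀) (cascadeWavelet ε₀ (𝒟.ψ i) n) t) :=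
    (modeProjection_isBandLimited 𝒟 i n (u t)).sub (isBandLimited_duhamelV hR hρ _ _ t)
  have hDd : IsFourierDivFree (modeProjection 𝒟 i n (u t) -
      duhamelV hR hρ g ((A : ℂ) • cascadeWavelet ε₀ (𝒟.ψ i₀) n₀) (cascadeWavelet ε₀ (𝒟.ψ i) n) t) := by
    have h1 : IsFourierDivFree (modeProjection 𝒟 i n (u t)) := (hu.1 t ht).2.2.modeProjection 𝒟 i n
    have h2 : IsFourierDivFree
        (duhamelV hR hρ g ((A : ℂ) • cascadeWavelet ε₀ (𝒟.ψ i₀) n₀) (cascadeWavelet ε₀ (𝒟.ψ i) n) t) :=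
      isFourierDivFree_duhamelV hR hρ hg _ _ ((𝒟.isFourierDivFree_cascadeWavelet hε i₀ n₀).smul _)
        (𝒟.isFourierDivFree_cascadeWavelet hε i n) t
    rw [sub_eq_add_neg, ← neg_one_smul ℂ
      (duhamelV hR hρ g ((A : ℂ) • cascadeWavelet ε₀ (𝒟.ψ i₀) n₀) (cascadeWavelet ε₀ (𝒟.ψ i) n) t)]
    exact h1.add (h2.smul _)
  have hDC := hDb.memH10dfC hρ hDd
  -- test with `Re D` and `Im D`
  have htest : ∀ {w : L2C}, MemH10df w → IsBandLimited (freqRegion 𝒟 i n) w →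
      ⟪w, modeProjection 𝒟 i n (u t) -
        duhamelV hR hρ g ((A : ℂ) • cascadeWavelet ε₀ (𝒟.ψ i₀) n₀) (cascadeWavelet ε₀ (𝒟.ψ i) n) t⟫_ℂ =
        0 := by
    intro w hw hwb
    rw [inner_sub_right,
      inner_modeProjection_eq_inner_duhamelV hε₀ hε 𝒟 α i₀ n₀ A S u hu i n ht hg hgt hw hwb, sub_self]
  have hre := htest hDC.memH10df_reL2 (hDb.reL2 hsymm)
  have him := htest hDC.memH10df_imL2 (hDb.imL2 hsymm)
  have h : ⟪reL2 (modeProjection 𝒟 i n (u t) -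
        duhamelV hR hρ g ((A : ℂ) • cascadeWavelet ε₀ (𝒟.ψ i₀) n₀) (cascadeWavelet ε₀ (𝒟.ψ i) n) t) +
      Complex.I • imL2 (modeProjection 𝒟 i n (u t) -
        duhamelV hR hρ g ((A : ℂ) • cascadeWavelet ε₀ (𝒟.ψ i₀) n₀) (cascadeWavelet ε₀ (𝒟.ψ i) n) t),
      modeProjection 𝒟 i n (u t) -
        duhamelV hR hρ g ((A : ℂ) • cascadeWavelet ε₀ (𝒟.ψ i₀) n₀) (cascadeWavelet ε₀ (𝒟.ψ i) n) t⟫_ℂ =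
      0 := by
    rw [inner_add_left, inner_smul_left, hre, him, mul_zero, add_zero]
  rw [reL2_add_I_smul_imL2] at h
  exact sub_eq_zero.1 (inner_self_eq_zero.1 h)

end Local

/-! ### The registered stub -/

/-- **Stub `modeNormBound` (line `Sketch` of crux `AveragedTypeIBlowup`).** For a mild solution of
the cascade equation (4.1)/(3.3) on `[0,S)` with datum `A ψ_{i₀,n₀}`, each Fourier projection
`u_{i,n}(t)` obeys the band Duhamel bound
`‖u_{i,n}(t)‖ ≤ e^{-4π²(1+ε₀)^{2n}t} |A| 1_{(i,n)=(i₀,n₀)} + ∫₀ᵗ |quadTerm(X)_{i,n}(s)| e^{-4π²(1+ε₀)^{2n}(t-s)} ds`: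
the projected Duhamel formula holds in `L²` (`modeProjection_eq_duhamelV`, with the drive clamped
to `[0,t]`), the band heat symbol is `≤ e^{-4π²(1+ε₀)^{2n}τ}` on the band (`norm_bandHeat_mode_le`),
`‖ψ_{i,n}‖ = 1`, and on the real fields of the solution the drive is the real `quadTerm` of the
coefficients `X_{j,k} = Re⟨u, ψ_{j,k}⟩` (`quadTermC_eq_ofReal`). [cite: Tao2016AveragedNS, §4 p. 22 (4.14)] -/
theorem stub_modeNormBound :
    ∀ {ε₀ : ℝ}, 0 < ε₀ → ε₀ ≤ 1 → ∀ {m : ℕ} (𝒟 : CascadeWaveletData ε₀ m)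
      (α : Fin m → Fin m → Fin m → ℤ × ℤ × ℤ → ℝ) (i₀ : Fin m) (n₀ : ℤ) (A S : ℝ) (u : ℝ → L2C),
      IsMildSolutionFor (cascadeOperatorForm ε₀ 𝒟.ψ α) ((A : ℂ) • cascadeWavelet ε₀ (𝒟.ψ i₀) n₀) (Ico 0 S) u →
      ∀ (i : Fin m) (n : ℤ), ∀ t ∈ Ico 0 S,
        ‖modeProjection 𝒟 i n (u t)‖ ≤
          Real.exp (-(4 * Real.pi ^ 2 * (1 + ε₀) ^ (2 * n) * t)) * (if i = i₀ ∧ n = n₀ then |A| else 0) +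
          ∫ s in (0 : ℝ)..t, |quadTerm ε₀ α (modeCoeff 𝒟 u) i n s| *
            Real.exp (-(4 * Real.pi ^ 2 * (1 + ε₀) ^ (2 * n) * (t - s))) := by
  intro ε₀ hε₀ _ m 𝒟 α i₀ n₀ A S u hu i n t ht
  have hε : 0 < 1 + ε₀ := by linarith
  have ht0 : (0 : ℝ) ≤ t := ht.1
  have hIcc : Icc 0 t ⊆ Ico 0 S := fun s hs => ⟨hs.1, hs.2.trans_lt ht.2⟩
  -- the drive `G_{i,n}(s) = quadTermC(u(s))_{i,n}`, clamped to `[0,t]`, is continuous on `ℝ`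
  have hclamp : ∀ s : ℝ, max 0 (min s t) ∈ Icc (0 : ℝ) t := fun s =>
    ⟨le_max_left _ _, max_le ht0 (min_le_right _ _)⟩
  have hcu : Continuous fun s : ℝ => u (max 0 (min s t)) :=
    (hu.2.1.continuousOn.mono hIcc).comp_continuous
      (continuous_const.max (continuous_id.min continuous_const)) hclamp
  obtain ⟨g, hg, hgt⟩ : ∃ g : ℝ → ℂ, Continuous g ∧
      ∀ s ∈ Icc (0 : ℝ) t, g s = quadTermC ε₀ 𝒟.ψ α (u s) i n := by
    refine ⟨fun s => quadTermC ε₀ 𝒟.ψ α (u (max 0 (min s t))) i n,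
      (continuous_quadTermC (𝒟 := 𝒟) (α := α) i n).comp hcu, fun s hs => ?_⟩
    simp only [min_eq_left hs.2, max_eq_right hs.1]
  -- on `[0,t]` the drive is the real `quadTerm` of the coefficients
  have hnorm : ∀ s ∈ Icc (0 : ℝ) t, ‖g s‖ = |quadTerm ε₀ α (modeCoeff 𝒟 u) i n s| := by
    intro s hs
    rw [hgt s hs, quadTermC_eq_ofReal (hu.1 s (hIcc hs)).2.1, Complex.norm_real, Real.norm_eq_abs]
    rfl
  -- the projected Duhamel formula in `L²`, then norms
  rw [modeProjection_eq_duhamelV hε₀ hε 𝒟 α i₀ n₀ A S u hu i n ht hg hgt,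
    duhamelV_eq (measurableSet_freqRegion 𝒟 i n) (freqRegion_subset_closedBall hε 𝒟 i n) hg]
  refine (norm_add_le _ _).trans (add_le_add (norm_bandHeat_datum_le hε₀ hε 𝒟 i i₀ n n₀ A ht0) ?_)
  refine intervalIntegral.norm_integral_le_of_norm_le ht0 (Eventually.of_forall fun s hs => ?_) ?_
  · have hs' : s ∈ Icc (0 : ℝ) t := Ioc_subset_Icc_self hs
    rw [norm_smul, hnorm s hs']
    refine mul_le_mul_of_nonneg_left ?_ (abs_nonneg _)
    have h := norm_bandHeat_mode_le hε 𝒟 i n (sub_nonneg.2 hs'.2) (cascadeWavelet ε₀ (𝒟.ψ i) n)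
    rwa [𝒟.norm_cascadeWavelet hε i n, mul_one] at h
  · have hc : Continuous fun s => ‖g s‖ * Real.exp (-(4 * Real.pi ^ 2 * (1 + ε₀) ^ (2 * n) * (t - s))) := by
      fun_prop
    refine (hc.continuousOn.congr fun s hs => ?_).intervalIntegrable
    rw [uIcc_of_le ht0] at hs
    simp only [hnorm s hs]

end Summit.NavierStokesRegularity.NavierStokesRegularity.Theorems.PerpetualPumpAveragedTypeIBlowup

end
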